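import Summits.QuantumFields.QCD.Theorems.HeatSlicedQuarksQuarkLoopCoefficientSecondOrderExpansionAuxL

/-!
# Second-order expansion of the heat symbol — part M: the Duhamel integrand at the origin
(line `Sketch` of crux stmt-QuantumFields-16786, stub `stub_secondOrderExpansion`, helper file)

At the origin the cocycle is trivial, so the twisted Duhamel integrand of `R₂(t)(0)` is the lattice series
`I(s) = Σ_y E_θ(t−s)(y) q₂(θ,s,−y)`.  Writing `E_θ = E₀ + θE₁ + R₂` and `q₂ = θ²F + θ³q₃' + q̃`
(`F = vtx2 E₀ + vtx1 E₁`, `q₃' = vtx3 E₀ + vtx2 E₁`) gives the pointwise split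
`I(s) = θ² I₁(s) + θ³ I₂(s) + I_err(s)` with `θ`-independent `I₁`, `I₂`; and the spin trace of `I₁(s)` is
exactly the integrand of the explicit coefficient `e2 t` (evenness of the free kernel).
-/

noncomputable section

namespace Summit.QuantumFields.QCD.Cruxes.QuarkLoopCoefficient.Sketch.SecondOrderExpansion

open Literature.MathematicalPhysics.QuantumLattice Literature.MathematicalPhysics.QuantumFieldTheory
open Literature.Probability.LatticeModels (Site)
open Summit.QuantumFields.QCD.Theorems.QuarkLoopCoefficient
open Summit.QuantumFields.QCD.Cruxes.QuarkLoopCoefficient.Sketch.HeatSeries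
open Summit.QuantumFields.QCD.Cruxes.QuarkLoopCoefficient.Sketch.FreeMajorantToolkit
open Summit.QuantumFields.QCD.Cruxes.QuarkLoopCoefficient.Sketch.SymmetricGauge
open scoped Matrix ComplexConjugate

/-- The twisted generator `(V_θ f)(w) = Σ_{v ∈ nbr2 0} Ω_θ(v, w) • (ȟ_θ(v) f(w − v))` (local notation). -/
local notation "V[" θ "]" => (fun (f : Site 4 → Spin) (w : Site 4) =>
  ∑ v ∈ nbr2 0, Complex.exp (((θ / 2 * (wedge v w : ℤ) : ℝ) : ℂ) * Complex.I) • (sqKer (symLink θ) 0 v * f (w - v)))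

/-- The second-order forcing `q₂(θ, s, w)` (local notation). -/
local notation "Q₂[" θ "," s "," w "]" => (V[θ] (pert0 s) w + (θ : ℂ) • V[θ] (pert1 s) w - vtx 0 (pert0 s) w -
  (θ : ℂ) • (vtx 0 (pert1 s) w + vtx 1 (pert0 s) w))

/-- The leading forcing `F(s, w) = vtx 2 (pert0 s) w + vtx 1 (pert1 s) w` (local notation). -/
local notation "F[" s "," w "]" => (vtx 2 (pert0 s) w + vtx 1 (pert1 s) w)

/-- The third-order forcing `q₃'(s, w) = vtx 3 (pert0 s) w + vtx 2 (pert1 s) w` (local notation). -/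
local notation "Q₃[" s "," w "]" => (vtx 3 (pert0 s) w + vtx 2 (pert1 s) w)

/-- The second-order remainder `R₂(θ, u, y) = E_θ(u)(y) − E₀(u)(y) − θ E₁(u)(y)` (local notation). -/
local notation "R₂[" θ "," u "," y "]" => (symHeat θ u y - pert0 u y - (θ : ℂ) • pert1 u y)

/-! ## §31 The representation at the origin and the pointwise split -/

/-- At the origin the twisted Duhamel integrand is phase-free. -/
theorem tsum_twisted_origin (θ u : ℝ) (q : Site 4 → Spin) :
    (∑' y : Site 4, Complex.exp (((θ / 2 * (wedge y 0 : ℤ) : ℝ) : ℂ) * Complex.I) • (symHeat θ u y * q (0 - y))) =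
      ∑' y : Site 4, symHeat θ u y * q (-y) :=
  tsum_congr fun y => by rw [cexp_wedge_zero, one_smul, zero_sub]

/-- **The pointwise algebraic split** of the integrand:
`E q₂ − θ²(E₀F) − θ³(E₀q₃' + E₁F) = E₀(q₂ − θ²F − θ³q₃') + θ • E₁(q₂ − θ²F) + R₂ q₂`. -/
theorem integrand_split (θ : ℂ) (E E₀ E₁ q F G : Spin) :
    E * q = θ ^ 2 • (E₀ * F) + θ ^ 3 • (E₀ * G + E₁ * F) +
      (E₀ * (q - θ ^ 2 • F - θ ^ 3 • G) + θ • (E₁ * (q - θ ^ 2 • F)) + (E - E₀ - θ • E₁) * q) := by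
  simp only [Matrix.mul_sub, Matrix.sub_mul, Matrix.mul_smul, Matrix.smul_mul, smul_sub, smul_add,
    smul_smul, ← pow_succ']
  norm_num
  abel

/-! ## §32 The trace of the leading term is the `e2` integrand -/

/-- `Σ_α (Σ_y E₀(u)(y) F(s,−y))_{αα} = Σ_w k_u(w) (tr vtx2(E₀ s)(w) + tr vtx1(E₁ s)(w))` for a summable
leading family (evenness of the free kernel and reindexing `y ↦ −y`). -/
theorem sum_diag_tsum_pert0_mul_eq
    (h7 : ∀ (t : ℝ) (w : Site 4), freeKer t (-w) = freeKer t w)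
    (u s : ℝ) (hS : Summable (fun y : Site 4 => pert0 u y * F[s, -y])) :
    ∑ α : Fin 4, (∑' y : Site 4, pert0 u y * F[s, -y]) α α =
      ∑' w : Site 4, ((freeKer u w : ℝ) : ℂ) * ((vtx 2 (pert0 s) w).trace + (vtx 1 (pert1 s) w).trace) := by
  have e1 : ∀ α : Fin 4, (∑' y : Site 4, pert0 u y * F[s, -y]) α α = ∑' y : Site 4, (pert0 u y * F[s, -y]) α α :=
    fun α => tsum_apply_apply hS α α
  simp_rw [e1]
  rw [← Summable.tsum_finsetSum (fun α _ => Pi.summable.mp (Pi.summable.mp hS α) α)]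
  have e2 : ∀ y : Site 4, ∑ α : Fin 4, (pert0 u y * F[s, -y]) α α =
      ((freeKer u (-y) : ℝ) : ℂ) * ((vtx 2 (pert0 s) (-y)).trace + (vtx 1 (pert1 s) (-y)).trace) := by
    intro y
    rw [h7, ← Matrix.trace_add]
    simp only [pert0, Matrix.smul_mul, Matrix.one_mul, Matrix.trace, Matrix.diag_apply, Matrix.smul_apply,
      smul_eq_mul, Finset.mul_sum]
  simp_rw [e2]
  exact (Equiv.neg (Site 4)).tsum_eq (fun y : Site 4 =>
    ((freeKer u y : ℝ) : ℂ) * ((vtx 2 (pert0 s) y).trace + (vtx 1 (pert1 s) y).trace))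

/-! ## §33 Summability of the integrand families -/

/-- **Summability and bounds of the four integrand families** at a time pair `(u, s) = (t − s, s)` in the
core regime: `E₀(u) F(s)`, `E₀(u) q₃'(s) + E₁(u) F(s)`, the error family, and the full family. -/
theorem integrand_families {Ck ck c₀ CE cE CR K C₁ Bm : ℝ} (hck : 0 < ck) (hc₀ : 0 < c₀) (hcE : 0 < cE)
    (hCk : 0 ≤ Ck) (hCE : 0 ≤ CE) (hCR : 0 ≤ CR) (hK : 0 ≤ K) (hC₁ : 0 ≤ C₁) (hBm : 0 ≤ Bm)
    (hk : ∀ t : ℝ, 0 ≤ t → ∀ w : Site 4, |freeKer t w| ≤ Ck * gaussProfile ck t w)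
    (hBmix : ∀ a b : ℝ, 0 ≤ a → 0 ≤ b → ∀ w : Site 4,
      Summable (fun y : Site 4 => gaussProfile ((1 - 1 / 2) * min cE (ck / 8)) a y *
        gaussProfile (min cE (ck / 8)) b (w - y)) ∧
      ∑' y : Site 4, gaussProfile ((1 - 1 / 2) * min cE (ck / 8)) a y * gaussProfile (min cE (ck / 8)) b (w - y) ≤
        Bm * gaussProfile ((1 - 1 / 2) * min cE (ck / 8)) (a + b) w)
    (hE₁ : ∀ s : ℝ, 0 ≤ s → ∀ (y : Site 4) (γ δ : Fin 4), ‖pert1 s y γ δ‖ ≤ C₁ * (1 + s) * gaussProfile (ck / 2) s y)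
    (hq : ∀ θ : ℝ, ∀ s : ℝ, 0 ≤ s → ∀ (w : Site 4) (γ δ : Fin 4),
      ‖(F[s, w]) γ δ‖ ≤ K * (1 + s) * gaussProfile (ck / 8) s w ∧
      ‖(Q₃[s, w]) γ δ‖ ≤ K * (1 + s) ^ 2 * gaussProfile (ck / 8) s w ∧
      ‖(Q₂[θ, s, w]) γ δ‖ ≤ K * (θ ^ 2 * (1 + s) + |θ| ^ 3 * (1 + s) ^ 2) * gaussProfile (ck / 8) s w ∧
      ‖(Q₂[θ, s, w] - (θ : ℂ) ^ 2 • F[s, w] - (θ : ℂ) ^ 3 • Q₃[s, w]) γ δ‖ ≤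
        K * θ ^ 4 * ((1 + s) ^ 2 + (1 + s) ^ 3) * gaussProfile (ck / 8) s w)
    (hGM : ∀ θ t : ℝ, 0 ≤ t → |θ| ≤ c₀ → |θ| * t ≤ c₀ →
      ∀ (w : Site 4) (α β : Fin 4), ‖symHeat θ t w α β‖ ≤ CE * gaussProfile cE t w)
    (hR : ∀ θ t : ℝ, 0 ≤ t → |θ| ≤ c₀ → |θ| * t ≤ c₀ → ∀ (w : Site 4) (α β : Fin 4),
      ‖(R₂[θ, t, w]) α β‖ ≤ CR * θ ^ 2 * (1 + t) ^ 2 * gaussProfile (min cE (ck / 8) / 2) t w)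
    (θ : ℝ) {t s : ℝ} (hs : 0 ≤ s) (hst : s ≤ t) (hθ : |θ| ≤ c₀) (hθt : |θ| * t ≤ c₀) :
    Summable (fun y : Site 4 => pert0 (t - s) y * F[s, -y]) ∧
    Summable (fun y : Site 4 => pert0 (t - s) y * Q₃[s, -y] + pert1 (t - s) y * F[s, -y]) ∧
    Summable (fun y : Site 4 =>
      pert0 (t - s) y * (Q₂[θ, s, -y] - (θ : ℂ) ^ 2 • F[s, -y] - (θ : ℂ) ^ 3 • Q₃[s, -y]) +
        (θ : ℂ) • (pert1 (t - s) y * (Q₂[θ, s, -y] - (θ : ℂ) ^ 2 • F[s, -y])) +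
        R₂[θ, t - s, y] * Q₂[θ, s, -y]) ∧
    Summable (fun y : Site 4 => symHeat θ (t - s) y * Q₂[θ, s, -y]) ∧
    (∀ α β : Fin 4, ‖(∑' y : Site 4,
      (pert0 (t - s) y * (Q₂[θ, s, -y] - (θ : ℂ) ^ 2 • F[s, -y] - (θ : ℂ) ^ 3 • Q₃[s, -y]) +
        (θ : ℂ) • (pert1 (t - s) y * (Q₂[θ, s, -y] - (θ : ℂ) ^ 2 • F[s, -y])) +
        R₂[θ, t - s, y] * Q₂[θ, s, -y])) α β‖ ≤
      (4 * Ck * (2 * K) + 4 * C₁ * (K * (1 + 4 * c₀)) + 4 * CR * (K * (1 + 2 * c₀))) *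
        Bm * θ ^ 4 * (1 + t) ^ 3 * gaussProfile (min cE (ck / 8) / 2) t 0) := by
  set c₁ : ℝ := min cE (ck / 8) with hc₁
  have hc₁E : c₁ ≤ cE := min_le_left _ _
  have hc₁k : c₁ ≤ ck / 8 := min_le_right _ _
  have hc₁0 : 0 < c₁ := lt_min hcE (by positivity)
  have hts : 0 ≤ t - s := sub_nonneg.mpr hst
  have ht : 0 ≤ t := hs.trans hst
  have hθ0 := abs_nonneg θ
  have hθs : |θ| * (1 + s) ≤ 2 * c₀ := by nlinarith
  -- profile weakenings
  have wk : ∀ u : ℝ, 0 ≤ u → ∀ y : Site 4, gaussProfile ck u y ≤ gaussProfile (c₁ / 2) u y :=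
    fun u hu y => gaussProfile_anti (by linarith) hu y
  have wk2 : ∀ u : ℝ, 0 ≤ u → ∀ y : Site 4, gaussProfile (ck / 2) u y ≤ gaussProfile (c₁ / 2) u y :=
    fun u hu y => gaussProfile_anti (by linarith) hu y
  have wk8 : ∀ y : Site 4, gaussProfile (ck / 8) s y ≤ gaussProfile c₁ s y :=
    fun y => gaussProfile_anti hc₁k hs y
  have wE : ∀ u : ℝ, 0 ≤ u → ∀ y : Site 4, gaussProfile cE u y ≤ gaussProfile (c₁ / 2) u y :=
    fun u hu y => gaussProfile_anti (by linarith) hu y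
  -- the left factors
  have aE₀ : ∀ (y : Site 4) (α γ : Fin 4), ‖pert0 (t - s) y α γ‖ ≤ Ck * gaussProfile (c₁ / 2) (t - s) y :=
    fun y α γ => (norm_pert0_apply_le hk hts y α γ).trans (mul_le_mul_of_nonneg_left (wk _ hts y) hCk)
  have aE₁ : ∀ (y : Site 4) (α γ : Fin 4), ‖pert1 (t - s) y α γ‖ ≤ C₁ * (1 + t) * gaussProfile (c₁ / 2) (t - s) y := by
    intro y α γ
    refine (hE₁ (t - s) hts y α γ).trans ?_
    have := wk2 _ hts y
    have hΓ := gaussProfile_nonneg (ck / 2) (t - s) y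
    calc C₁ * (1 + (t - s)) * gaussProfile (ck / 2) (t - s) y ≤ C₁ * (1 + t) * gaussProfile (ck / 2) (t - s) y := by
          gcongr; linarith
      _ ≤ _ := mul_le_mul_of_nonneg_left this (by positivity)
  have aE : ∀ (y : Site 4) (α γ : Fin 4), ‖symHeat θ (t - s) y α γ‖ ≤ CE * gaussProfile (c₁ / 2) (t - s) y := by
    intro y α γ
    refine (hGM θ (t - s) hts hθ ?_ y α γ).trans (mul_le_mul_of_nonneg_left (wE _ hts y) hCE)
    calc |θ| * (t - s) ≤ |θ| * t := by gcongr; linarith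
      _ ≤ c₀ := hθt
  have aR : ∀ (y : Site 4) (α γ : Fin 4), ‖(R₂[θ, t - s, y]) α γ‖ ≤ CR * θ ^ 2 * (1 + t) ^ 2 * gaussProfile (c₁ / 2) (t - s) y := by
    intro y α γ
    refine (hR θ (t - s) hts hθ ?_ y α γ).trans ?_
    · calc |θ| * (t - s) ≤ |θ| * t := by gcongr; linarith
        _ ≤ c₀ := hθt
    · have hΓ := gaussProfile_nonneg (c₁ / 2) (t - s) y
      gcongr; linarith
  -- the right factors
  have bF : ∀ (y : Site 4) (γ β : Fin 4), ‖(F[s, y]) γ β‖ ≤ K * (1 + s) * gaussProfile c₁ s y :=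
    fun y γ β => ((hq θ s hs y γ β).1).trans (mul_le_mul_of_nonneg_left (wk8 y) (by positivity))
  have bG : ∀ (y : Site 4) (γ β : Fin 4), ‖(Q₃[s, y]) γ β‖ ≤ K * (1 + s) ^ 2 * gaussProfile c₁ s y :=
    fun y γ β => ((hq θ s hs y γ β).2.1).trans (mul_le_mul_of_nonneg_left (wk8 y) (by positivity))
  have hpoly2 : θ ^ 2 * (1 + s) + |θ| ^ 3 * (1 + s) ^ 2 ≤ (1 + 2 * c₀) * θ ^ 2 * (1 + s) := by
    have e : |θ| ^ 3 * (1 + s) ^ 2 = θ ^ 2 * (1 + s) * (|θ| * (1 + s)) := by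
      rw [show |θ| ^ 3 = |θ| ^ 2 * |θ| by ring, sq_abs]; ring
    rw [e]
    have h2 : 0 ≤ θ ^ 2 * (1 + s) := by positivity
    nlinarith [mul_le_mul_of_nonneg_left hθs h2]
  have bQ : ∀ (y : Site 4) (γ β : Fin 4), ‖(Q₂[θ, s, y]) γ β‖ ≤ K * (1 + 2 * c₀) * θ ^ 2 * (1 + s) * gaussProfile c₁ s y := by
    intro y γ β
    refine ((hq θ s hs y γ β).2.2.1).trans ?_
    have hΓ' := gaussProfile_nonneg (ck / 8) s y
    calc K * (θ ^ 2 * (1 + s) + |θ| ^ 3 * (1 + s) ^ 2) * gaussProfile (ck / 8) s y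
        ≤ K * ((1 + 2 * c₀) * θ ^ 2 * (1 + s)) * gaussProfile c₁ s y := by gcongr; exact wk8 y
      _ = _ := by ring
  have bT : ∀ (y : Site 4) (γ β : Fin 4), ‖(Q₂[θ, s, y] - (θ : ℂ) ^ 2 • F[s, y] - (θ : ℂ) ^ 3 • Q₃[s, y]) γ β‖ ≤
      2 * K * θ ^ 4 * (1 + s) ^ 3 * gaussProfile c₁ s y := by
    intro y γ β
    refine ((hq θ s hs y γ β).2.2.2).trans ?_
    have hΓ' := gaussProfile_nonneg (ck / 8) s y
    have hs1 : (1 + s) ^ 2 ≤ (1 + s) ^ 3 := pow_le_pow_right₀ (by linarith) (by norm_num)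
    calc K * θ ^ 4 * ((1 + s) ^ 2 + (1 + s) ^ 3) * gaussProfile (ck / 8) s y
        ≤ K * θ ^ 4 * ((1 + s) ^ 3 + (1 + s) ^ 3) * gaussProfile c₁ s y := by gcongr; exact wk8 y
      _ = _ := by ring
  have bD : ∀ (y : Site 4) (γ β : Fin 4), ‖(Q₂[θ, s, y] - (θ : ℂ) ^ 2 • F[s, y]) γ β‖ ≤
      K * (1 + 4 * c₀) * |θ| ^ 3 * (1 + s) ^ 2 * gaussProfile c₁ s y := by
    intro y γ β
    have hsplit : Q₂[θ, s, y] - (θ : ℂ) ^ 2 • F[s, y] =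
        (Q₂[θ, s, y] - (θ : ℂ) ^ 2 • F[s, y] - (θ : ℂ) ^ 3 • Q₃[s, y]) + (θ : ℂ) ^ 3 • Q₃[s, y] := by abel
    rw [hsplit, Matrix.add_apply]
    refine (norm_add_le _ _).trans ((add_le_add (bT y γ β) (norm_smul_apply_le _ (bG y) γ β)).trans ?_)
    rw [norm_pow, Complex.norm_real, Real.norm_eq_abs]
    have hΓ' := gaussProfile_nonneg c₁ s y
    have hθ4 : θ ^ 4 = |θ| ^ 3 * |θ| := by
      rw [← Even.pow_abs (by decide : Even 4) θ]; ring
    have key : 2 * K * θ ^ 4 * (1 + s) ^ 3 + |θ| ^ 3 * (K * (1 + s) ^ 2) ≤ K * (1 + 4 * c₀) * |θ| ^ 3 * (1 + s) ^ 2 := by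
      rw [hθ4]
      have h2 : 0 ≤ K * |θ| ^ 3 * (1 + s) ^ 2 := by positivity
      nlinarith [mul_le_mul_of_nonneg_left hθs h2]
    calc 2 * K * θ ^ 4 * (1 + s) ^ 3 * gaussProfile c₁ s y + |θ| ^ 3 * (K * (1 + s) ^ 2 * gaussProfile c₁ s y)
        = (2 * K * θ ^ 4 * (1 + s) ^ 3 + |θ| ^ 3 * (K * (1 + s) ^ 2)) * gaussProfile c₁ s y := by ring
      _ ≤ _ := mul_le_mul_of_nonneg_right key hΓ'
  -- assemble with the origin convolution lemma
  have conv := fun {E q : Site 4 → Spin} {a b : ℝ} (ha : 0 ≤ a) (hb : 0 ≤ b)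
    (hE : ∀ (y : Site 4) (α γ : Fin 4), ‖E y α γ‖ ≤ a * gaussProfile (c₁ / 2) (t - s) y)
    (hq : ∀ (y : Site 4) (γ β : Fin 4), ‖q y γ β‖ ≤ b * gaussProfile c₁ s y) =>
    originConv_summable_and_norm_le hBmix ha hb hts hs hE hq
  have s1 := conv hCk (by positivity : 0 ≤ K * (1 + s)) aE₀ bF
  have s2a := conv hCk (by positivity : 0 ≤ K * (1 + s) ^ 2) aE₀ bG
  have s2b := conv (by positivity : 0 ≤ C₁ * (1 + t)) (by positivity : 0 ≤ K * (1 + s)) aE₁ bF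
  have s3a := conv hCk (by positivity : 0 ≤ 2 * K * θ ^ 4 * (1 + s) ^ 3) aE₀ bT
  have s3b := conv (by positivity : 0 ≤ C₁ * (1 + t)) (by positivity : 0 ≤ K * (1 + 4 * c₀) * |θ| ^ 3 * (1 + s) ^ 2)
    aE₁ bD
  have s3c := conv (by positivity : 0 ≤ CR * θ ^ 2 * (1 + t) ^ 2)
    (by positivity : 0 ≤ K * (1 + 2 * c₀) * θ ^ 2 * (1 + s)) aR bQ
  have s4 := conv hCE (by positivity : 0 ≤ K * (1 + 2 * c₀) * θ ^ 2 * (1 + s)) aE bQ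
  have hsub : t - s + s = t := sub_add_cancel t s
  refine ⟨s1.1, s2a.1.add s2b.1, (s3a.1.add (s3b.1.const_smul (θ : ℂ))).add s3c.1, s4.1, fun α β => ?_⟩
  -- the error bound: three pieces
  rw [(s3a.1.add (s3b.1.const_smul (θ : ℂ))).tsum_add s3c.1, s3a.1.tsum_add (s3b.1.const_smul (θ : ℂ)),
    (s3b.1).tsum_const_smul (θ : ℂ), Matrix.add_apply, Matrix.add_apply, Matrix.smul_apply, smul_eq_mul]
  have q1 := s3a.2 α β
  have q2 : ‖(θ : ℂ) * (∑' y : Site 4, pert1 (t - s) y * (Q₂[θ, s, -y] - (θ : ℂ) ^ 2 • F[s, -y])) α β‖ ≤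
      |θ| * (4 * (C₁ * (1 + t)) * (K * (1 + 4 * c₀) * |θ| ^ 3 * (1 + s) ^ 2) * Bm *
        gaussProfile (c₁ / 2) (t - s + s) 0) := by
    rw [norm_mul, Complex.norm_real, Real.norm_eq_abs]
    exact mul_le_mul_of_nonneg_left (s3b.2 α β) hθ0
  have q3 := s3c.2 α β
  rw [hsub] at q1 q2 q3
  refine (norm_add_le _ _).trans ?_
  refine (add_le_add (norm_add_le _ _) le_rfl).trans ?_
  refine (add_le_add (add_le_add q1 q2) q3).trans ?_
  have hΓ := gaussProfile_nonneg (c₁ / 2) t 0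
  have hs1 : 1 + s ≤ 1 + t := by linarith
  have hs0 : 0 ≤ 1 + s := by linarith
  have hθ4 : |θ| * |θ| ^ 3 = θ ^ 4 := by
    rw [show |θ| * |θ| ^ 3 = |θ| ^ 4 by ring, Even.pow_abs (by decide)]
  have hθ22 : θ ^ 2 * θ ^ 2 = θ ^ 4 := by ring
  -- bound each piece by `const * Bm * θ⁴ (1+t)³ Γ`
  have p1 : 4 * Ck * (2 * K * θ ^ 4 * (1 + s) ^ 3) * Bm * gaussProfile (c₁ / 2) t 0 ≤
      4 * Ck * (2 * K) * Bm * θ ^ 4 * (1 + t) ^ 3 * gaussProfile (c₁ / 2) t 0 := by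
    have : (1 + s) ^ 3 ≤ (1 + t) ^ 3 := pow_le_pow_left₀ hs0 hs1 3
    calc 4 * Ck * (2 * K * θ ^ 4 * (1 + s) ^ 3) * Bm * gaussProfile (c₁ / 2) t 0
        = 4 * Ck * (2 * K) * Bm * θ ^ 4 * (1 + s) ^ 3 * gaussProfile (c₁ / 2) t 0 := by ring
      _ ≤ _ := by gcongr
  have p2 : |θ| * (4 * (C₁ * (1 + t)) * (K * (1 + 4 * c₀) * |θ| ^ 3 * (1 + s) ^ 2) * Bm * gaussProfile (c₁ / 2) t 0) ≤
      4 * C₁ * (K * (1 + 4 * c₀)) * Bm * θ ^ 4 * (1 + t) ^ 3 * gaussProfile (c₁ / 2) t 0 := by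
    have : (1 + t) * (1 + s) ^ 2 ≤ (1 + t) ^ 3 := by
      rw [pow_succ' (1 + t) 2]; gcongr
    calc |θ| * (4 * (C₁ * (1 + t)) * (K * (1 + 4 * c₀) * |θ| ^ 3 * (1 + s) ^ 2) * Bm * gaussProfile (c₁ / 2) t 0)
        = 4 * C₁ * (K * (1 + 4 * c₀)) * Bm * (|θ| * |θ| ^ 3) * ((1 + t) * (1 + s) ^ 2) *
            gaussProfile (c₁ / 2) t 0 := by ring
      _ ≤ 4 * C₁ * (K * (1 + 4 * c₀)) * Bm * θ ^ 4 * (1 + t) ^ 3 * gaussProfile (c₁ / 2) t 0 := by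
          rw [hθ4]; gcongr
  have p3 : 4 * (CR * θ ^ 2 * (1 + t) ^ 2) * (K * (1 + 2 * c₀) * θ ^ 2 * (1 + s)) * Bm * gaussProfile (c₁ / 2) t 0 ≤
      4 * CR * (K * (1 + 2 * c₀)) * Bm * θ ^ 4 * (1 + t) ^ 3 * gaussProfile (c₁ / 2) t 0 := by
    have : (1 + t) ^ 2 * (1 + s) ≤ (1 + t) ^ 3 := by
      rw [pow_succ (1 + t) 2]; gcongr
    calc 4 * (CR * θ ^ 2 * (1 + t) ^ 2) * (K * (1 + 2 * c₀) * θ ^ 2 * (1 + s)) * Bm * gaussProfile (c₁ / 2) t 0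
        = 4 * CR * (K * (1 + 2 * c₀)) * Bm * (θ ^ 2 * θ ^ 2) * ((1 + t) ^ 2 * (1 + s)) *
            gaussProfile (c₁ / 2) t 0 := by ring
      _ ≤ 4 * CR * (K * (1 + 2 * c₀)) * Bm * θ ^ 4 * (1 + t) ^ 3 * gaussProfile (c₁ / 2) t 0 := by
          rw [hθ22]; gcongr
  have := add_le_add (add_le_add p1 p2) p3
  refine this.trans (le_of_eq ?_)
  ring

/-! ## Registered headline -/

/-- Registered headline of this helper file (aux stub `stub_secondOrderExpansionAuxM` of crux
stmt-QuantumFields-16786, line `Sketch`): the pointwise algebraic split of the Duhamel integrand. -/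
theorem stub_secondOrderExpansionAuxM : ∀ (θ : ℂ) (E E₀ E₁ q F G : Spin), E * q = θ ^ 2 • (E₀ * F) + θ ^ 3 • (E₀ * G + E₁ * F) + (E₀ * (q - θ ^ 2 • F - θ ^ 3 • G) + θ • (E₁ * (q - θ ^ 2 • F)) + (E - E₀ - θ • E₁) * q) :=
  integrand_split

end Summit.QuantumFields.QCD.Cruxes.QuarkLoopCoefficient.Sketch.SecondOrderExpansion

end
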